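import Mathlib
import Summits.NavierStokesRegularity.NavierStokesRegularity.Theses.EulerZoomLiouville
import Summits.NavierStokesRegularity.NavierStokesRegularity.Theorems.EulerZoomLiouvillePowerGaugeEulerLiouvilleLargeRho
import Summits.NavierStokesRegularity.NavierStokesRegularity.Theorems.EulerZoomLiouvilleSereginZoomReduction
import Summits.NavierStokesRegularity.NavierStokesRegularity.Theorems.EulerZoomLiouvillePowerGaugeEulerLiouvilleWindowIdentity
import Summits.NavierStokesRegularity.NavierStokesRegularity.Theorems.EulerZoomLiouvillePowerGaugeEulerLiouvilleLionsGate
import HarnessLib.Audit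

/-!
# Line `lions-gate` (ideator ns-idea-11 g5, lens «complete» = program-completion) for the crux
# `EulerZoomLiouville.PowerGaugeEulerLiouville` (stmt-NavierStokesRegularity-19832)

PROGRAMME COMPLETED.  The ENERGY-EQUALITY-CRITERIA programme for weak incompressible flows in the energy class
`L^∞_t L²_x ∩ L²_t H¹_x`: J.-L. Lions (1960, Thm. 1: `u ∈ L⁴(0,T;L⁴)` ⇒ equality), Shinbrot (SIAM J. Math. Anal. 5 (1974):
`u ∈ L^q_t L^p_x`, `2/q + 2/p ≤ 1`, `p ≥ 4` — the dimension-free mollification mechanism, printed with proof as Sohr 2001, Ch. V,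
Thm. 1.4.1), Cheskidov–Constantin–Friedlander–Shvydkoy (arXiv:0704.0759, Thm. 3.3: Euler, `L³_t B^{1/3}_{3,c(ℕ)}`),
Berselli–Chiodaroli (2020) and Cheskidov–Luo (arXiv:1802.05785 §1; SIAM J. Math. Anal. 53 (2021) §1.3: sharpness) — whose
AUTHOR-NAMED GAP is the energy class itself: «does every weak solution in `L^∞L² ∩ L²H¹` (Leray–Hopf) satisfy the energy
equality?» (open since Lions 1960; Cheskidov–Luo 2020 §1).  The tree holds the mechanism, formalised on the torus:
`Literature.Analysis.FluidPDE.lions_energy_equality_Ioc'` (`…DuchonRobertLionsEnergyEqualityGeneral`: "the dimension-free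
mechanism of Shinbrot's proof", key slice estimate `‖∫⟪v,(v·∇)P_N v⟫‖ ≤ ‖v‖₄² ‖∇(P_N v − v)‖₂`).

THE OBSERVATION THIS LINE TYPES.  In Lions'/Shinbrot's proof the viscosity is used for ONE thing: to put `∇u` in `L²_{t,x}`.  In
Seregin's power-gauged ancient EULER class (the crux's class) the E-GAUGE `∫∫_{Q(a)} |∇u|² ≤ c a^{1−ρ}` supplies exactly that,
at every scale, with no viscosity.  Hence (O1, `stub_lionsGate`, M): **a member of the class with `u ∈ L⁴_loc` up to the final
time satisfies the LOCAL ENERGY EQUALITY** — integrability GATES anomalous dissipation inside the class; equivalently the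
dissipative residue of the crux (line `extinct-trace`, X4a) consists of `L⁴`-ROUGH members only (the class gives `L^{10/3}_loc`
by interpolation; the gap `10/3 < 4` is the Leray–Hopf gap, verbatim).  Self-similar members `|τ|^{γ−1}V(y/|τ|^γ)` are
`L⁴_loc` iff `ρ < 1/3` (time exponent `7γ − 4 > −1`), and conservative for every `ρ` (classical), so the gate does not touch
the needle: it is a structure theorem for the residue, not a Liouville theorem.
(O2, `stub_windowIdentity`, M) types the reusable lemma the critic asked for (V44 P3): a CONSERVATIVE member satisfies the exact
backward bookkeeping `E_χ(σ) − E_χ(s) = ∫_s^σ ∫ (|u|²+2p) u·∇χ` for every spatial test `χ` and a.e. `s < σ < 0` — the common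
first step of `extinct-trace` X2/X3 and of any conservative-class edit of the crux.  CHORE rev (2026-08-28T16:0xZ): O2 is FILLED BY
NAME — width ns-ezl-w6 g2 landed p645814 `Theorems/…WindowIdentity.lean` (`WindowIdentity.hasWindowIdentity_of_isEnergyConservative`,
predicate bodies verbatim); `stub_windowIdentity` is now that theorem (sorries 4 → 3).  CHORE rev 2 (2026-08-28T16:3xZ): O1 is FILLED BY
NAME — width ns-ezl-w1 g4 landed p648026 `Theorems/…LionsGate.lean` (`LionsGate.isEnergyConservative_of_memL4Loc`, bodies verbatim;
Literature `ae_localEnergyEquality_of_L4` p646579 + `integral_integral_localEnergy_eq_of_L4` p647573): in the crux class `u ∈ L⁴_loc` ⇒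
conservative ⇒ exact window identity is now a TREE FACT (sorries 3 → 2: exactly the residues O3 `stub_identityCore` / O4
`stub_roughDissipative`, both OPEN and not claimed).

TYPED DICTIONARY (NS side; critic V44 P1 — DEFINITIONS and CHECKED INTERFACE LEMMAS, not stubs, not used by the composition):
`ConservativeLiouville ρ` (the crux restricted to conservative members), `PowerZoomData`/`L3Floor`/`PrefinalBounded` (the
hypotheses of the route's LANDED `SereginZoomReduction` + Seregin's first-singularity standing assumption arXiv:2507.08733 p. 3,
«v ∈ L_∞(B × ]−1,−a²[) for all a»), `SereginZoomReductionConservative` (the reduction outputs a CONSERVATIVE member under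
`PrefinalBounded` — arXiv:2507.08733 p. 5: "we can take the limit … and get the local energy identity for the Euler equations"),
the checked `member_of_data` (our vocabulary is definitionally the route's: it invokes `sereginZoomReduction_proof`) and the checked
`noFloor_of_dictionary : ConservativeLiouville-window → SereginZoomReductionConservative → (data ∧ prefinal-bounded ⇒ ¬ floor)` —
the exact shape in which a conservative-class edit of 19832 would re-glue the route.  Route-level remark for the director/LEAD.

RESIDUES (OPEN, not claimed): O3 `stub_identityCore` — members with the exact window identity (= conservative members) are
trivial: the CORE, containing every self-similar / DSS candidate; O4 `stub_roughDissipative` — dissipative members, which by O1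
are `L⁴`-rough: the Leray–Hopf gap transplanted (irrelevant for the NS route by the dictionary, open for the crux as typed).

No summit is proved by a line: this file is a skeleton (stubs O3, O4 are `sorry`; O1, O2 are tree theorems since the chore revs); its
kernel-checked content is the composition
`PowerGaugeEulerLiouville_of`, the dictionary interface lemmas and the sanity lemmas.
-/

noncomputable section

set_option linter.dupNamespace false

open MeasureTheory Set Filter Topology Metric Real
open scoped ENNReal NNReal RealInnerProductSpace
open Literature.Analysis Literature.Analysis.FluidPDE

namespace Summit.NavierStokesRegularity.NavierStokesRegularity.Cruxes.PowerGaugeEulerLiouville.LionsGate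

/-- Local abbreviation: ℝ³. -/
abbrev E3 : Type := EuclideanSpace ℝ (Fin 3)

/-- Membership in Seregin's power-gauged ancient Euler class — verbatim the three hypotheses of the crux (same as `Birth.InClass`). -/
@[reducible] def InClass (ρ : ℝ) (u : ℝ → E3 → E3) (p : ℝ → E3 → ℝ) (H : ℝ → E3 → E3 →L[ℝ] E3)
    (c : ℝ≥0) : Prop :=
  IsSuitableWeakSolutionOn (slab (EuclideanSpace ℝ (Fin 3)) (Set.Iio 0) isOpen_Iio) 0 0 u p ∧
    HasWeakSpatialGradientOn (slab (EuclideanSpace ℝ (Fin 3)) (Set.Iio 0) isOpen_Iio) u H ∧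
    (∀ a : ℝ, 0 < a →
      ENNReal.ofReal (a ^ (2 * ρ)) * cknA a (0 : ℝ × E3) u + ENNReal.ofReal (a ^ ρ) * cknE a (0 : ℝ × E3) H +
        ENNReal.ofReal (a ^ (2 * ρ)) * cknD a (0 : ℝ × E3) p ≤ (c : ℝ≥0∞))

/-- The conclusion of the crux: `u` vanishes a.e. on the past slab. -/
@[reducible] def VanishesAE (u : ℝ → E3 → E3) : Prop :=
  Function.uncurry u =ᵐ[volume.restrict (Set.Iio (0 : ℝ) ×ˢ (Set.univ : Set E3))] 0

/-! ## The objects -/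

/-- **Conservative member** (verbatim as in line `extinct-trace`): the local energy EQUALITY of Euler on the past slab, in the
iterated-integral form of `IsSuitableWeakSolutionOn` (CKN (2.5) with `=`).  Inside `InClass` every integrand below is integrable
(`u ∈ L³_loc`, `p u ∈ L¹_loc`), so no Bochner junk value can occur in the stubs; as a free-standing predicate it should be read
together with `InClass` (critic V44 R1). -/
def IsEnergyConservative (u : ℝ → E3 → E3) (p : ℝ → E3 → ℝ) : Prop :=
  ∀ φ : ℝ → E3 → ℝ, IsSpaceTimeTestOn (slab (EuclideanSpace ℝ (Fin 3)) (Set.Iio 0) isOpen_Iio) φ →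
    ∫ t, ∫ x, (‖u t x‖ ^ 2 * timeDeriv φ t x + (‖u t x‖ ^ 2 + 2 * p t x) * ⟪u t x, gradient (φ t) x⟫) = 0

/-- **`L⁴`-integrability up to the final time** (Lions' class, localised): `∫∫_{(−a²,0) × B_a} |u|⁴ < ∞` for every `a > 0` (the
cylinders exhaust `ℝ³ × (−∞,0)` and reach `τ = 0`).  Lower Lebesgue integral: junk-free.  The class itself only gives
`u ∈ L^{10/3}_loc` (interpolation of the A- and E-gauges). -/
def MemL4Loc (u : ℝ → E3 → E3) : Prop :=
  ∀ a : ℝ, 0 < a → ∫⁻ z in Set.Ioo (-(a ^ 2)) 0 ×ˢ Metric.ball (0 : E3) a, ‖u z.1 z.2‖ₑ ^ (4 : ℕ) < ⊤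

/-- **Exact window identity** (the backward bookkeeping a conservative member admits and a dissipative one does not): for every
smooth compactly supported spatial cutoff `χ` there is a null set of times outside which, for all `s < σ < 0`,
`∫ χ|u(σ)|² − ∫ χ|u(s)|² = ∫_s^σ ∫ (|u|² + 2p) ⟪u, ∇χ⟫`. -/
def HasWindowIdentity (u : ℝ → E3 → E3) (p : ℝ → E3 → ℝ) : Prop :=
  ∀ χ : E3 → ℝ, ContDiff ℝ (⊤ : ℕ∞) χ → HasCompactSupport χ →
    ∃ N : Set ℝ, volume N = 0 ∧ ∀ s σ : ℝ, s < σ → σ < 0 → s ∉ N → σ ∉ N →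
      (∫ x, χ x * ‖u σ x‖ ^ 2) - (∫ x, χ x * ‖u s x‖ ^ 2) =
        ∫ τ in Set.Ioo s σ, ∫ x, (‖u τ x‖ ^ 2 + 2 * p τ x) * ⟪u τ x, gradient χ x⟫

/-! ## Registered stub signatures -/

/-- O1 (M — **the Lions gate**): a member with `u ∈ L⁴_loc` up to the final time is conservative.  Proof plan = Shinbrot's
mollification argument with the E-gauge in place of viscosity: mollify the momentum equation in space, test with `φ u_ε`
(`φ` a space–time test), the trilinear defect `|∫∫ φ ⟪u,(u·∇)(u_ε − u)⟫|`-type terms are `≤ ‖u‖²_{L⁴(supp φ)} ‖∇(u_ε − u)‖_{L²(supp φ)} → 0`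
(pattern: the tree's torus lemma `Torus.enorm_integral_inner_convect_fourierTruncate_self_le_of_isWeaklyDivFree` and
`lions_energy_equality_Ioc'`), the pressure term passes because `p u ∈ L^{12/11}_loc`, the time derivative by Steklov averaging;
the limit is the equality for `φ`. -/
def Sig.stub_lionsGate : Prop :=
  ∀ (ρ : ℝ) (u : ℝ → E3 → E3) (p : ℝ → E3 → ℝ) (H : ℝ → E3 → E3 →L[ℝ] E3) (c : ℝ≥0),
    InClass ρ u p H c → MemL4Loc u → IsEnergyConservative u p

/-- O2 (M — **window identity of conservative members**; critic V44 P3): test the equality with `η(t)χ(x)`, let `η → 1_{(s,σ)}` at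
Lebesgue points of `t ↦ ∫χ|u(t)|²` (an `L^∞_loc` function by the A-gauge; the flux density `(|u|²+2p)⟪u,∇χ⟫ ∈ L¹_loc` by the
E- and D-gauges), collect the exceptional times of countably many `χ`'s is NOT needed (the null set may depend on `χ`). -/
def Sig.stub_windowIdentity : Prop :=
  ∀ (ρ : ℝ) (u : ℝ → E3 → E3) (p : ℝ → E3 → ℝ) (H : ℝ → E3 → E3 →L[ℝ] E3) (c : ℝ≥0),
    InClass ρ u p H c → IsEnergyConservative u p → HasWindowIdentity u p

/-- O3 (OPEN residue = the CORE, not claimed): members with the exact window identity — i.e. the conservative members — are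
trivial.  Contains every self-similar / DSS candidate of the Chae–Shvydkoy window (classical ⇒ conservative). -/
def Sig.stub_identityCore : Prop :=
  ∀ ρ : ℝ, 0 < ρ → ρ ≤ 1 / 2 → ∀ (u : ℝ → E3 → E3) (p : ℝ → E3 → ℝ) (H : ℝ → E3 → E3 →L[ℝ] E3) (c : ℝ≥0),
    InClass ρ u p H c → HasWindowIdentity u p → VanishesAE u

/-- O4 (OPEN residue, not claimed): DISSIPATIVE members — which by O1 are `L⁴`-rough — are trivial.  This is the Leray–Hopf
energy-equality gap transplanted to the gauged Euler class; irrelevant for the NS route (first-singularity zoom limits are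
conservative, dictionary below), open for the crux as typed. -/
def Sig.stub_roughDissipative : Prop :=
  ∀ ρ : ℝ, 0 < ρ → ρ ≤ 1 / 2 → ∀ (u : ℝ → E3 → E3) (p : ℝ → E3 → ℝ) (H : ℝ → E3 → E3 →L[ℝ] E3) (c : ℝ≥0),
    InClass ρ u p H c → ¬ IsEnergyConservative u p → ¬ MemL4Loc u → VanishesAE u

/-! ## Stubs -/

/-- STUB O1 [FILLED BY NAME since chore rev 2 — width ns-ezl-w1 g4, p648026 ACCEPTED `Theorems/…LionsGate.lean` (adapted ESS
mollification on cylinders; Literature `ae_localEnergyEquality_of_L4` p646579, `integral_integral_localEnergy_eq_of_L4` p647573);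
M — the Lions gate: `L⁴_loc` members are conservative]. -/
theorem stub_lionsGate : Sig.stub_lionsGate := by
  intro ρ u p H c hcls hL4
  exact Summit.NavierStokesRegularity.NavierStokesRegularity.Theorems.PowerGaugeEulerLiouville.LionsGate.isEnergyConservative_of_memL4Loc
    ρ u p H c hcls hL4

/-- STUB O2 [FILLED BY NAME — width ns-ezl-w6 g2, p645814 ACCEPTED `Theorems/…WindowIdentity.lean`:
`WindowIdentity.hasWindowIdentity_of_isEnergyConservative` (the three predicate bodies verbatim)]. -/
theorem stub_windowIdentity : Sig.stub_windowIdentity := by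
  intro ρ u p H c hcls hcons
  exact Summit.NavierStokesRegularity.NavierStokesRegularity.Theorems.PowerGaugeEulerLiouville.WindowIdentity.hasWindowIdentity_of_isEnergyConservative
    hcls hcons

/-- STUB O3 [OPEN residue = the core, not claimed]. -/
theorem stub_identityCore : Sig.stub_identityCore := by
  sorry

/-- STUB O4 [OPEN residue, not claimed: rough dissipative members]. -/
theorem stub_roughDissipative : Sig.stub_roughDissipative := by
  sorry

/-! ## Composition (kernel-checked): the four stubs imply the crux BY NAME -/

/-- `ρ > 1/2`: the landed `powerGaugeEulerLiouville_largeRho`; `0 < ρ ≤ 1/2`: a conservative member has the window identity (O2) and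
goes to the core O3; a dissipative member is `L⁴`-rough by the gate O1 (contrapositive) and goes to O4. -/
theorem PowerGaugeEulerLiouville_of :
    Sig.stub_lionsGate → Sig.stub_windowIdentity → Sig.stub_identityCore → Sig.stub_roughDissipative →
      Summit.NavierStokesRegularity.NavierStokesRegularity.Theses.EulerZoomLiouville.PowerGaugeEulerLiouville := by
  intro h1 h2 h3 h4 ρ hρ u p H c hsw hH hc
  by_cases hhalf : 1 / 2 < ρ
  · exact
      Summit.NavierStokesRegularity.NavierStokesRegularity.Theorems.PowerGaugeEulerLiouville.powerGaugeEulerLiouville_largeRho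
        ρ hhalf u p H c hsw hH hc
  · have hρ2 : ρ ≤ 1 / 2 := not_lt.mp hhalf
    have hIn : InClass ρ u p H c := ⟨hsw, hH, hc⟩
    by_cases hC : IsEnergyConservative u p
    · exact h3 ρ hρ hρ2 u p H c hIn (h2 ρ u p H c hIn hC)
    · exact h4 ρ hρ hρ2 u p H c hIn hC (fun h4l => hC (h1 ρ u p H c hIn h4l))

/-! ## Typed dictionary (NS side) — definitions and checked interface lemmas; NOT stubs, NOT used by the composition -/

/-- The crux restricted to CONSERVATIVE members on the window `0 < ρ ≤ 1/2` — the candidate conservative-class edit of 19832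
(route-level remark; a consequence of the crux, see `conservativeLiouville_of_crux`). -/
def ConservativeLiouville : Prop :=
  ∀ ρ : ℝ, 0 < ρ → ρ ≤ 1 / 2 → ∀ (u : ℝ → E3 → E3) (p : ℝ → E3 → ℝ) (H : ℝ → E3 → E3 →L[ℝ] E3) (c : ℝ≥0),
    InClass ρ u p H c → IsEnergyConservative u p → VanishesAE u

/-- NS-side data of the route's landed reduction `SereginZoomReduction` (its hypotheses, verbatim): a suitable weak Navier–Stokes
solution `(v,q)` with weak gradient `G` in the parabolic ball of radius `r₀` at `z₀`, obeying Seregin's power-gauged bound (1.7). -/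
def PowerZoomData (ρ r₀ : ℝ) (z₀ : ℝ × E3) (v : ℝ → E3 → E3) (q : ℝ → E3 → ℝ) (G : ℝ → E3 → E3 →L[ℝ] E3) : Prop :=
  0 < r₀ ∧ IsSuitableWeakSolutionInBall r₀ z₀ v q ∧ HasWeakSpatialGradientOn (parabolicCylinderOpens r₀ z₀) v G ∧
    (∃ M : NNReal, ∀ r ∈ Set.Ioc 0 r₀,
      ENNReal.ofReal (r ^ (2 * ρ)) * cknA r z₀ v + ENNReal.ofReal (r ^ ρ) * cknE r z₀ G +
        ENNReal.ofReal (r ^ (2 * ρ)) * cknD r z₀ q ≤ (M : ENNReal))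

/-- The singular floor (3.1) of the reduction, verbatim: `r^{2ρ−2} ∫∫_{(t₀−r^{2+ρ},t₀) × B(x₀,r)} |v|³ ≥ ε₀` along `r ↓ 0`. -/
def L3Floor (ρ : ℝ) (z₀ : ℝ × E3) (v : ℝ → E3 → E3) : Prop :=
  ∃ ε₀ : ℝ, 0 < ε₀ ∧ ∀ δ : ℝ, 0 < δ → ∃ r ∈ Set.Ioo 0 δ,
    ENNReal.ofReal ε₀ ≤ ENNReal.ofReal (r ^ (2 * ρ - 2)) *
      ∫⁻ w in Set.Ioo (z₀.1 - r ^ (2 + ρ)) z₀.1 ×ˢ Metric.ball z₀.2 r, ‖v w.1 w.2‖ₑ ^ (3 : ℕ)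

/-- Seregin's FIRST-SINGULARITY standing assumption (arXiv:2507.08733 p. 3: `v ∈ L_∞(B × ]−1,−a²[)` for all `a ∈ ]0,1[`): the
solution is essentially bounded in the ball strictly before the final time. -/
def PrefinalBounded (r₀ : ℝ) (z₀ : ℝ × E3) (v : ℝ → E3 → E3) : Prop :=
  ∀ a ∈ Set.Ioo 0 r₀, ∃ K : ℝ,
    ∀ᵐ w ∂(volume.restrict (Set.Ioo (z₀.1 - r₀ ^ 2) (z₀.1 - a ^ 2) ×ˢ Metric.ball z₀.2 r₀)), ‖v w.1 w.2‖ ≤ K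

/-- **The conservative reduction** (NS side, typed; arXiv:2507.08733 §2, p. 5): under the first-singularity assumption the Euler
zoom limit produced by the reduction can be taken CONSERVATIVE.  A typed Prop for the lead/director (it is NS-side work, not an
item of this Euler crux); with it and `ConservativeLiouville` the route re-glues (`noFloor_of_dictionary`). -/
def SereginZoomReductionConservative : Prop :=
  ∀ ρ : ℝ, 0 < ρ → ρ ≤ 1 / 2 → ∀ (r₀ : ℝ) (z₀ : ℝ × E3) (v : ℝ → E3 → E3) (q : ℝ → E3 → ℝ) (G : ℝ → E3 → E3 →L[ℝ] E3),
    PowerZoomData ρ r₀ z₀ v q G → PrefinalBounded r₀ z₀ v → L3Floor ρ z₀ v →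
      ∃ (u : ℝ → E3 → E3) (p : ℝ → E3 → ℝ) (H : ℝ → E3 → E3 →L[ℝ] E3) (c : ℝ≥0),
        InClass ρ u p H c ∧ IsEnergyConservative u p ∧ ¬ VanishesAE u

/-- CHECKED: our NS-side vocabulary is definitionally the route's — the landed `sereginZoomReduction_proof` yields, from
`PowerZoomData` and `L3Floor`, a member of the class that is not a.e. zero. No sorry. -/
theorem member_of_data {ρ : ℝ} (hρ : 0 < ρ) (hρ2 : ρ ≤ 1 / 2) {r₀ : ℝ} {z₀ : ℝ × E3} {v : ℝ → E3 → E3}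
    {q : ℝ → E3 → ℝ} {G : ℝ → E3 → E3 →L[ℝ] E3} (hD : PowerZoomData ρ r₀ z₀ v q G) (hF : L3Floor ρ z₀ v) :
    ∃ (u : ℝ → E3 → E3) (p : ℝ → E3 → ℝ) (H : ℝ → E3 → E3 →L[ℝ] E3) (c : ℝ≥0), InClass ρ u p H c ∧ ¬ VanishesAE u := by
  obtain ⟨hr₀, hsw, hG, hM⟩ := hD
  obtain ⟨u, p, H, c, h1, h2, h3, h4⟩ :=
    Summit.NavierStokesRegularity.NavierStokesRegularity.Theorems.SereginZoomReduction.sereginZoomReduction_proof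
      ρ hρ hρ2 r₀ z₀ v q G hr₀ hsw hG hM hF
  exact ⟨u, p, H, c, ⟨h1, h2, h3⟩, h4⟩

/-- CHECKED: the crux implies the conservative-class statement (it is a restriction). -/
theorem conservativeLiouville_of_crux
    (h : Summit.NavierStokesRegularity.NavierStokesRegularity.Theses.EulerZoomLiouville.PowerGaugeEulerLiouville) :
    ConservativeLiouville :=
  fun ρ hρ _ u p H c hIn _ => h ρ hρ u p H c hIn.1 hIn.2.1 hIn.2.2

/-- CHECKED (the re-glue shape): with the conservative reduction in hand, the conservative-class Liouville statement already
excludes the power-gauged first-singularity scenario — no NS solution with `PowerZoomData`, bounded before the final time, keeps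
the `L³` floor.  Pure logic; the two hypotheses are the typed NS-side / Euler-side halves of the dictionary. -/
theorem noFloor_of_dictionary (hL : ConservativeLiouville) (hR : SereginZoomReductionConservative)
    {ρ : ℝ} (hρ : 0 < ρ) (hρ2 : ρ ≤ 1 / 2) {r₀ : ℝ} {z₀ : ℝ × E3} {v : ℝ → E3 → E3} {q : ℝ → E3 → ℝ}
    {G : ℝ → E3 → E3 →L[ℝ] E3} (hD : PowerZoomData ρ r₀ z₀ v q G) (hB : PrefinalBounded r₀ z₀ v) :
    ¬ L3Floor ρ z₀ v := by
  intro hF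
  obtain ⟨u, p, H, c, hIn, hC, hne⟩ := hR ρ hρ hρ2 r₀ z₀ v q G hD hB hF
  exact hne (hL ρ hρ hρ2 u p H c hIn hC)

/-! ## Sanity lemmas (kernel-checked, tiny) -/

/-- The zero field is `L⁴_loc`. -/
theorem memL4Loc_zero : MemL4Loc (fun _ _ => (0 : E3)) := by
  intro a ha
  simp

/-- The zero pair is conservative (no junk: every integrand is literally zero). -/
theorem isEnergyConservative_zero : IsEnergyConservative (fun _ _ => (0 : E3)) (fun _ _ => (0 : ℝ)) := by
  intro φ hφ
  simp

/-- The zero pair has the window identity (with the empty exceptional set). -/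
theorem hasWindowIdentity_zero : HasWindowIdentity (fun _ _ => (0 : E3)) (fun _ _ => (0 : ℝ)) := by
  intro χ hχ hχc
  refine ⟨∅, by simp, ?_⟩
  intro s σ _ _ _ _
  simp

/-- The `L⁴` time-exponent of a self-similar member `|τ|^{γ−1}V(y/|τ|^γ)`, `γ = 1/(2+ρ)`, is `7γ − 4`; it is `> −1` (local
integrability at `τ = 0`) iff `ρ < 1/3`: the gate does not touch the self-similar needle for `ρ ≥ 1/3`, and for `ρ < 1/3` the
needle is inside the gate (and conservative anyway). -/
theorem selfSimilar_L4_exponent_iff (ρ : ℝ) (hρ : 0 < ρ) : -1 < 7 * (1 / (2 + ρ)) - 4 ↔ ρ < 1 / 3 := by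
  have h2 : 0 < 2 + ρ := by linarith
  rw [show 7 * (1 / (2 + ρ)) - 4 = 7 / (2 + ρ) - 4 by ring]
  constructor
  · intro h
    have h3 : 3 < 7 / (2 + ρ) := by linarith
    rw [lt_div_iff₀ h2] at h3
    linarith
  · intro h
    have h3 : 3 < 7 / (2 + ρ) := by
      rw [lt_div_iff₀ h2]
      linarith
    linarith

end Summit.NavierStokesRegularity.NavierStokesRegularity.Cruxes.PowerGaugeEulerLiouville.LionsGate
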